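import Literature.NumberTheory.GaloisRepresentations.RestrictionCalculus
import HarnessLib

/-!
# Continuous cohomology along an isomorphism of topological groups

Topic `NumberTheory/GaloisRepresentations` (continuous cochain cohomology); namespace
`Literature.NumberTheory.GaloisRepresentations`.  THEOREMS ONLY (no definition, no named fact, no `sorry`,
no instance).

For an isomorphism of topological groups `e : G ≃ₜ* G′` and representations `σ` of `G′`, `τ` of `G` on the
SAME topological module with `τ(g) = σ(e g)`, the maps induced on Mathlib's continuous cohomology by `e`
and `e⁻¹` are mutually inverse (`ContinuousCohomology.map_comp`, `map_id`), whence an additive isomorphism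
`Hq(G, τ) ≃+ Hq(G′, σ)` in every degree (`nonempty_continuousCohomology_addEquiv_of_continuousMulEquiv`;
the vanishing-only form is the tree's `subsingleton_iff_of_continuousMulEquiv`).  Used by lane «TATE-EPC-TC»
(cell `bsd-eis`, stmt-BirchSwinnertonDyer-19032) to move `Hq(Gal(K_S/E), E_S)` between two presentations of
the open subgroup `Gal(K_S/E) ≤ G_{K,S}`.  HONEST FRAMING: homological plumbing only.

## References
* J.-P. Serre, *Cohomologie galoisienne* (1994), I §2.2 (functoriality of `Hq`). [SerreGaloisCohomology1997]
-/

noncomputable section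

open CategoryTheory Function

universe u

namespace Literature.NumberTheory.GaloisRepresentations

open _root_.TopRep _root_.ContRepresentation _root_.ContinuousCohomology

section Transport

variable {k : Type*} [CommRing k] [TopologicalSpace k]
variable {G : Type u} [Group G] [TopologicalSpace G] [IsTopologicalGroup G]
variable {G' : Type u} [Group G'] [TopologicalSpace G'] [IsTopologicalGroup G']
variable {M : Type u} [AddCommGroup M] [Module k M] [TopologicalSpace M] [IsTopologicalAddGroup M]
  [ContinuousSMul k M]

/-- **`Hq` along an isomorphism of topological groups**: for `e : G ≃ₜ* G′`, representations `σ` of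
`G′` and `τ` of `G` on the same topological module with `τ(g) = σ(e g)`, the maps induced by `e` and
`e⁻¹` on continuous cohomology are mutually inverse additive isomorphisms `Hq(G, τ) ≃+ Hq(G′, σ)`
(Mathlib `ContinuousCohomology.map_comp`, `map_id`; cf. the tree's `subsingleton_iff_of_continuousMulEquiv`).
[cite: SerreGaloisCohomology1997, I §2.2] -/
theorem nonempty_continuousCohomology_addEquiv_of_continuousMulEquiv (e : G ≃ₜ* G')
    (σ : ContinuousRep G' k M) (τ : ContinuousRep G k M) (hστ : ∀ g m, τ g m = σ (e g) m) (q : ℕ) :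
    Nonempty ((continuousCohomology q τ.toTopRep : Type u) ≃+
      (continuousCohomology q σ.toTopRep : Type u)) := by
  let f : TopRep.res ((e : G →ₜ* G') : G →* G') σ.toTopRep ⟶ τ.toTopRep :=
    TopRep.ofHom ⟨ContinuousLinearMap.id k M, fun g => by
      ext m
      exact (hστ g m).symm⟩
  let g : TopRep.res ((e.symm : G' →ₜ* G) : G' →* G) τ.toTopRep ⟶ σ.toTopRep :=
    TopRep.ofHom ⟨ContinuousLinearMap.id k M, fun x => by
      ext m
      change τ (e.symm x) m = σ x m
      rw [hστ, ContinuousMulEquiv.apply_symm_apply]⟩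
  have hcomp₁ : ContinuousCohomology.map (e : G →ₜ* G') f q ≫
      ContinuousCohomology.map (e.symm : G' →ₜ* G) g q = 𝟙 _ := by
    rw [← ContinuousCohomology.map_comp]
    refine continuousCohomology_map_eq_id _ _ ?_ (fun x => rfl) q
    ext x
    simp
  have hcomp₂ : ContinuousCohomology.map (e.symm : G' →ₜ* G) g q ≫
      ContinuousCohomology.map (e : G →ₜ* G') f q = 𝟙 _ := by
    rw [← ContinuousCohomology.map_comp]
    refine continuousCohomology_map_eq_id _ _ ?_ (fun x => rfl) q
    ext x
    simp
  have key₁ : ∀ x, (ContinuousCohomology.map (e.symm : G' →ₜ* G) g q).hom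
      ((ContinuousCohomology.map (e : G →ₜ* G') f q).hom x) = x := fun x => by
    have hx := congr_arg (fun φ => φ.hom x) hcomp₁
    simpa using hx
  have key₂ : ∀ y, (ContinuousCohomology.map (e : G →ₜ* G') f q).hom
      ((ContinuousCohomology.map (e.symm : G' →ₜ* G) g q).hom y) = y := fun y => by
    have hy := congr_arg (fun φ => φ.hom y) hcomp₂
    simpa using hy
  -- `Hq(e, f) : Hq(G′, σ) → Hq(G, τ)` with inverse `Hq(e⁻¹, g)`
  exact ⟨{ toFun := fun y => (ContinuousCohomology.map (e.symm : G' →ₜ* G) g q).hom y,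
            invFun := fun x => (ContinuousCohomology.map (e : G →ₜ* G') f q).hom x,
            left_inv := fun y => key₂ y,
            right_inv := fun x => key₁ x,
            map_add' := fun a b => map_add _ a b }⟩

end Transport

end Literature.NumberTheory.GaloisRepresentations

end
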